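import Summits.QuantumFields.BalabanUV.T4Continuum.Support.ShellMeasureLocalGradientTail

/-!
# `T4Continuum.ShellMeasureGradientTailLevels` — WALL §2 (a) item (P4) AT THE LIVE LEVELS `j ≥ 1`: the (97)∕(98) SHAPE
# for the `∇`-FREE PLAQUETTE PART `V₀′` of [Balaban1985Variational] (39)∕(40), MULTI-GRID (one weight per bond), KERNEL
# (cell `pub-balaban`, sub-cell `t4`, spine estimate NE7c (node U5b), crew lineage `b2b-balaban-t4-ne7c-formalise-leaf-02`
# gen 8, owner table `LEAVES-NE7c-P1.md` row S65 file f2b; imports the owner's S62 f1 `ShellMeasureLocalGradientTail`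
# (`sgl`, `locGrad`, `locGrad_sum_eq_filter`; through it `B8SectDSource.norm_fderiv_le_of_norm_le`) ONLY; [folklore];
# 0 sorry)

HONEST FRAMING.  Finite four-torus programme, rung (B)+1 only — NOT infinite volume, NOT a mass gap, NOT the Clay
problem, NOT summit progress; (B), `BetaPertHyp`, (B^μ) are not consumed.  NE7c (`T4IndicatorShell.ShellWeightBound`)
is NOT PRINTED and NOT PROVED; «NE7c ⇐ the named binders» (WALL `t4/b2b-balaban-t4-ne7c-p1/WALL-NE7c-P1.md` §2).
ELEMENTARY COMPLEX ANALYSIS on complex normed spaces ([folklore]): the Cauchy estimate in ONE bond variable at a radius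
proportional to the field's own weighted size.  Nothing printed is asserted or cited as a fact; no `def` and no
`def … : Prop` is minted.  HONEST DEPENDENCY (cell): continuum YM on T⁴ ⇐ BetaPertH ∧ nine spine estimates (0/9
proved); BetaPertH ⇐ (D1) ∧ (D4) ∧ CAP+tail; G-an2-4 gates asym, D1 and NE2/3/4.

THE POINT (locator `HOME/b2b-balaban-t4-ne7c-formalise-leaf-02/XREAD-P4-B11-SectB.md`, GAPS C-ne7cleaf02g8-1).  The
owner's S62 (`ShellMeasureLocalGradientTail.prop4Hyp_locGrad`) is the ONE-GRID face of END-II's binder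
`hW : ∀ V, Prop4Hyp (W𝒱 V) C₄ a₃` ([Balaban1985Variational] = cell paper B11, Prop. 4 (97)–(98)): sup norms, one
weight.  In print the bound lives on the MULTI-GRID geometry `Ω₀ ⊃ Ω₁ ⊃ … ⊃ Ω_k` (p. 292–293, verbatim, LOCATOR
ONLY — the paper is under adjudication): *«|((δ∕δA′)V)(A′)| < C₄ε₃²(Lʲη)^{−3} on Ω_j, j = 0, 1, …, k. (97) The constants
a₃, C₄ depend on d and L only. The above estimate can be formulated also in the following way: |((δ∕δA′)V)(A′)|_{(−3)}
≤ C₄(max{|A′|_{(−1)}, |∇A′|_{(−2)}})², (98)»*, with the weighted sup norm displayed once on p. 286: *«sup_j Lʲη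
sup_{Ω_j}|A′| = |A′|_{(−1)}»*.  The locator's census: `|∇A′|_{(−2)}` enters ONLY through the first term of (39); the
plaquette REMAINDER `V₀′` is controlled «in |A| alone» by the CUBIC display (40), p. 284: *«|V₀′(A,∂p)| ≤ … ≤
64|A|³(C₁B₃ε₁ + ε₂)(Lʲη)^{−1} … (40) Here we have used only the first bound (32) on the field A alone»*, and its
gradient by the p. 291 sentence *«The derivative ((∂∕∂A(b))V₀′)(A,∂p) satisfies a bound similar to the bound (40) for
the function V₀′(A,∂p), but with the power of |A| lower by 1, and with a different absolute constant»* — a sentence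
of printed TYPE whose content is the Cauchy estimate in one bond variable.  WHAT THIS FILE PROVES, for ABSTRACT data
(a finite bond set `Λ` with a weight `w b > 0` per bond — for Bałaban `w b = L^{j(b)}η`, `j(b) = max{j : b ∈ Ω_j}` —,
a finite plaquette set `Pl` with supports `supp p`, a weight `W p > 0` per plaquette with `W p ≤ w b ≤ Lc·W p` on
`supp p` (`Lc ≥ 1` the one-step scale jump, `Lc = 1` when all bonds of `∂p` carry p's scale), incidence `#st(b) ≤ m`,
and LOCAL functionals `φ_p` analytic on the weighted polydisc `{A : ∀ b ∈ supp p, ‖A b‖ < ε∕W p}` obeying there the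
(40)-SHAPE cubic bound `‖φ_p A‖ ≤ (κ∕W p)·s³` whenever `‖A b‖ ≤ s` on `supp p` — `κ` a DISPLAYED BINDER, for Bałaban's
`V₀′` the number `64(C₁B₃ε₁ + ε₂)` carrying (14)∕(38), never proved here):
* §1 `norm_fderiv_comp_sgl_le_weighted`: ONE plaquette, ONE bond `b ∈ supp p` of weight `wb`, a field of weighted
  size `≤ s` (`‖A b′‖ ≤ s∕W p` on `supp p`): for every `t > 0` with `s + t < ε`,
  `wb³·‖Dφ_p(A) ∘ ι_b‖ ≤ κ·Lc⁴·(s + t)³∕t` (Cauchy in the variable `A(b)` at radius `t∕wb`), hence (§2, `t ↓ s`)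
  `wb³·‖Dφ_p(A) ∘ ι_b‖ ≤ 8·κ·Lc⁴·s²` for `2s < ε` — «the power of |A| lower by 1» with the absolute constant `8·Lc⁴`
  at half radius;
* §3 **`weighted_locGrad_le`**: for `V(A) = Σ_{p ∈ Pl} φ_p(A)` and a field with `w b·‖A b‖ ≤ s` for all `b`, `2s < ε`:
  `(w b)³·‖locGrad V A b‖ ≤ 8·κ·m·Lc⁴·s²` for EVERY bond `b` — i.e. `|locGrad V A|_{(−3)} ≤ 8κ m Lc⁴·|A|²_{(−1)}`,
  the (98) SHAPE for the `∇`-free part with a constant made of (one plaquette) × (incidence) × (scale jump)⁴,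
  independent of `#Pl`, `#Λ` (the volume) and of the number of scales (k-UNIFORM) — the live-level content of «C₄
  depends on d and L only» for this part; (97)'s display is the same inequality bond by bond (`weighted_locGrad_le'`);
* §4 `analyticOnNhd_sum_wBall`, `differentiableOn_locGrad_wBall`: `V` is analytic and `locGrad V` is ℂ-differentiable
  on the weighted ball `{A : ∀ b, w b·‖A b‖ < ε}` (the `DifferentiableOn` clause of `Prop4Hyp`, in flat coordinates;
  the companion file `ShellMeasureMultiGridNorms` transports §3–§4 to the weighted normed spaces and states
  `Prop4Hyp` literally);
* §5 a non-vacuity witness (one plaquette, `φ A = (ℓ(A b₀))³`).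
NOT HERE (and said in every headline): the `∇`-PART of (98) — the first term `½ tr(DA)(p) Σ i[A′(b₁),A′(b₂)]` of (39)
and its dressed variants (91)–(96), whose multi-scale gain is the integration by parts (93) + [6] (1.52) = (96) (the
naive bound loses exactly `Lʲ` there, locator §3 (k)); it needs a concrete covariant lattice calculus (`D`, `D*`,
plaquette ↔ (site, μ, ν) — b08's `B8Eq151V2Divergence` typing); the `HD`-dressing `A′ ↦ A′ − HD(A′)` of (80)∕(90) (row
S66); the identification of `Σ_p φ_p` with Bałaban's sectioned `V₀′` and of `W𝒱 V` with its gradient (node O, [dict]).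
So this is the live-level KERNEL face of the `∇`-free half of ONE W-a binder's plaquette part; no estimate of
Bałaban's is discharged.
-/

noncomputable section

open Metric Set Filter
open scoped Topology

namespace Summit.QuantumFields.BalabanUV.T4Continuum.ShellMeasureGradientTailLevels

open Literature.MathematicalPhysics.QuantumFieldTheory.Balaban1983to89
open B8SectDSource (norm_fderiv_le_of_norm_le)
open Summit.QuantumFields.BalabanUV.T4Continuum.ShellMeasureLocalGradientTail
  (sgl sgl_apply norm_sgl_le locGrad locGrad_apply locGrad_sum_eq_filter)

variable {Λ : Type*} [Fintype Λ] [DecidableEq Λ] {𝔄 : Type*} [NormedAddCommGroup 𝔄] [NormedSpace ℂ 𝔄]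

/-! ## §1 One plaquette, one bond: the Cauchy estimate in the variable `A(b)` at a weighted radius -/

/-- The single-bond perturbation `X ↦ A + ι_b X` moves only the `b`-coordinate: `(A + ι_b X) b′ = A b′` for `b′ ≠ b`
and `= A b + X` for `b′ = b`. [folklore] -/
theorem add_sgl_apply (A : Λ → 𝔄) (b b' : Λ) (X : 𝔄) :
    (A + sgl b X) b' = A b' + if b' = b then X else 0 := by
  rw [Pi.add_apply, sgl_apply]
  by_cases h : b' = b
  · subst h; simp
  · simp [h]

/-- The derivative of `φ` at `A` in the single-bond direction `b` is the derivative at `0` of `X ↦ φ (A + ι_b X)`.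
[folklore] -/
theorem hasFDerivAt_comp_add_sgl {φ : (Λ → 𝔄) → ℂ} {A : Λ → 𝔄} (hφ : DifferentiableAt ℂ φ A) (b : Λ) :
    HasFDerivAt (fun X : 𝔄 => φ (A + sgl b X)) ((fderiv ℂ φ A).comp (sgl b)) 0 := by
  have h1 : HasFDerivAt (fun X : 𝔄 => A + sgl b X) (sgl b : 𝔄 →L[ℂ] (Λ → 𝔄)) 0 :=
    ((sgl b : 𝔄 →L[ℂ] (Λ → 𝔄)).hasFDerivAt).const_add A
  have h2 : HasFDerivAt φ (fderiv ℂ φ A) (A + sgl b (0 : 𝔄)) := by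
    rw [map_zero, add_zero]
    exact hφ.hasFDerivAt
  exact h2.comp (0 : 𝔄) h1

omit [Fintype Λ] [DecidableEq Λ] [NormedSpace ℂ 𝔄] in
/-- The plaquette polydisc `{A : ∀ b′ ∈ S, ‖A b′‖ < ρ}` is open. [folklore] -/
theorem isOpen_polydisc (S : Finset Λ) (ρ : ℝ) : IsOpen {A : Λ → 𝔄 | ∀ b' ∈ S, ‖A b'‖ < ρ} := by
  have h : {A : Λ → 𝔄 | ∀ b' ∈ S, ‖A b'‖ < ρ} = ⋂ b' ∈ S, {A : Λ → 𝔄 | ‖A b'‖ < ρ} := by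
    ext A
    simp
  rw [h]
  exact isOpen_biInter_finset fun b' _ => isOpen_lt (continuous_norm.comp (continuous_apply b')) continuous_const

/-- **ONE PLAQUETTE, ONE BOND, WEIGHTED CAUCHY.**  Data: a functional `φ` ℂ-differentiable on the polydisc
`{A : ∀ b′ ∈ S, ‖A b′‖ < ε∕Wp}` of a finite bond set `S` (the support) with the (40)-SHAPE cubic bound
`‖φ A‖ ≤ (κ∕Wp)·σ³` whenever `‖A b′‖ ≤ σ` on `S` and `σ < ε∕Wp`; a bond `b` of weight `wb` with `Wp ≤ wb ≤ Lc·Wp` (for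
`b ∉ S` the conclusion is trivially compatible — locality is not even needed here); a
field `A` in the polydisc with `‖A b′‖ ≤ s∕Wp` on `S`.  Then for every `t > 0` with `s + t < ε`:
`wb³·‖Dφ(A) ∘ ι_b‖ ≤ κ·Lc⁴·(s + t)³∕t` — the Cauchy estimate for `X ↦ φ(A + ι_b X)` on the ball of radius `t∕wb`, on
which the local size is `≤ (s + t)∕Wp`.  ([Balaban1985Variational] p. 291: «a bound similar to the bound (40) … with the
power of |A| lower by 1» — locator only; nothing printed is asserted.) [folklore] -/
theorem norm_fderiv_comp_sgl_le_weighted {φ : (Λ → 𝔄) → ℂ} {S : Finset Λ} {ε κ Wp wb Lc s t : ℝ}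
    (hWp : 0 < Wp) (hκ : 0 ≤ κ) (hLc1 : 1 ≤ Lc)
    (hd : DifferentiableOn ℂ φ {A : Λ → 𝔄 | ∀ b' ∈ S, ‖A b'‖ < ε / Wp})
    (hcub : ∀ (A : Λ → 𝔄) (σ : ℝ), 0 ≤ σ → σ < ε / Wp → (∀ b' ∈ S, ‖A b'‖ ≤ σ) → ‖φ A‖ ≤ κ / Wp * σ ^ 3)
    {b : Λ} (hwb : Wp ≤ wb) (hwL : wb ≤ Lc * Wp)
    {A : Λ → 𝔄} (hs : 0 ≤ s) (hA : ∀ b' ∈ S, ‖A b'‖ ≤ s / Wp) (ht : 0 < t) (hst : s + t < ε) :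
    wb ^ 3 * ‖(fderiv ℂ φ A).comp (sgl b)‖ ≤ κ * Lc ^ 4 * (s + t) ^ 3 / t := by
  have hwb0 : 0 < wb := hWp.trans_le hwb
  have hLc0 : 0 < Lc := one_pos.trans_le hLc1
  -- the radius in the `b`-coordinate and the local size on the perturbed ball
  set r : ℝ := t / wb with hr
  have hr0 : 0 < r := div_pos ht hwb0
  have hrWp : r ≤ t / Wp := div_le_div_of_nonneg_left ht.le hWp hwb
  set σ : ℝ := (s + t) / Wp with hσ
  have hσε : σ < ε / Wp := div_lt_div_of_pos_right hst hWp
  have hσ0 : 0 ≤ σ := div_nonneg (by linarith) hWp.le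
  -- points of the ball stay in the polydisc, with local size ≤ σ
  have hsize : ∀ X : 𝔄, ‖X‖ < r → ∀ b' ∈ S, ‖(A + sgl b X) b'‖ ≤ σ := by
    intro X hX b' hb'
    rw [add_sgl_apply]
    by_cases h : b' = b
    · rw [if_pos h]
      calc ‖A b' + X‖ ≤ ‖A b'‖ + ‖X‖ := norm_add_le _ _
        _ ≤ s / Wp + t / Wp := add_le_add (hA b' hb') (hX.le.trans hrWp)
        _ = σ := by rw [hσ, add_div]
    · rw [if_neg h, add_zero]
      calc ‖A b'‖ ≤ s / Wp := hA b' hb'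
        _ ≤ σ := div_le_div_of_nonneg_right (by linarith) hWp.le
  have hmaps : MapsTo (fun X : 𝔄 => A + sgl b X) (ball 0 r) {A : Λ → 𝔄 | ∀ b' ∈ S, ‖A b'‖ < ε / Wp} := by
    intro X hX b' hb'
    exact (hsize X (mem_ball_zero_iff.1 hX) b' hb').trans_lt hσε
  -- the one-variable (one-bond) function and its derivative at 0
  have hdΦ : DifferentiableOn ℂ (fun X : 𝔄 => φ (A + sgl b X)) (ball 0 r) :=
    hd.comp (((sgl b : 𝔄 →L[ℂ] (Λ → 𝔄)).differentiable.const_add A).differentiableOn) hmaps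
  have hMΦ : ∀ X ∈ ball (0 : 𝔄) r, ‖φ (A + sgl b X)‖ ≤ κ / Wp * σ ^ 3 := fun X hX =>
    hcub _ σ hσ0 hσε (hsize X (mem_ball_zero_iff.1 hX))
  have hA0 : A ∈ {A : Λ → 𝔄 | ∀ b' ∈ S, ‖A b'‖ < ε / Wp} := by
    simpa using hmaps (mem_ball_self hr0)
  have hφA : DifferentiableAt ℂ φ A := hd.differentiableAt ((isOpen_polydisc S _).mem_nhds hA0)
  have hder : fderiv ℂ (fun X : 𝔄 => φ (A + sgl b X)) 0 = (fderiv ℂ φ A).comp (sgl b) :=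
    (hasFDerivAt_comp_add_sgl hφA b).fderiv
  -- Cauchy
  have hC := norm_fderiv_le_of_norm_le hdΦ hMΦ (x := (0 : 𝔄)) (by simpa using hr0)
  rw [hder, norm_zero, sub_zero] at hC
  -- arithmetic: wb³ · (κ/Wp·σ³/r) = κ (s+t)³ wb⁴/(Wp⁴ t) ≤ κ Lc⁴ (s+t)³/t
  have hkey : wb ^ 3 * (κ / Wp * σ ^ 3 / r) = κ * (wb / Wp) ^ 4 * (s + t) ^ 3 / t := by
    rw [hσ, hr]
    field_simp
  have hratio : (wb / Wp) ^ 4 ≤ Lc ^ 4 := by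
    have h1 : wb / Wp ≤ Lc := (div_le_iff₀ hWp).2 hwL
    have h0 : 0 ≤ wb / Wp := div_nonneg hwb0.le hWp.le
    exact pow_le_pow_left₀ h0 h1 4
  calc wb ^ 3 * ‖(fderiv ℂ φ A).comp (sgl b)‖ ≤ wb ^ 3 * (κ / Wp * σ ^ 3 / r) :=
      mul_le_mul_of_nonneg_left hC (pow_nonneg hwb0.le 3)
    _ = κ * (wb / Wp) ^ 4 * (s + t) ^ 3 / t := hkey
    _ ≤ κ * Lc ^ 4 * (s + t) ^ 3 / t := by
      have h3 : 0 ≤ (s + t) ^ 3 / t := div_nonneg (pow_nonneg (by linarith) 3) ht.le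
      have := mul_le_mul_of_nonneg_left hratio hκ
      calc κ * (wb / Wp) ^ 4 * (s + t) ^ 3 / t = κ * (wb / Wp) ^ 4 * ((s + t) ^ 3 / t) := by ring
        _ ≤ κ * Lc ^ 4 * ((s + t) ^ 3 / t) := mul_le_mul_of_nonneg_right this h3
        _ = κ * Lc ^ 4 * (s + t) ^ 3 / t := by ring

/-! ## §2 The radius `t ↓ s`: «the power of |A| lower by 1» with the absolute constant `8·Lc⁴` -/

/-- From `x ≤ C·(s + τ)²` for all small `τ > 0` conclude `x ≤ C·s²` (continuity at `τ = 0⁺`). [folklore] -/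
theorem le_mul_sq_of_forall_add {x C s τ₀ : ℝ} (hτ₀ : 0 < τ₀)
    (h : ∀ τ : ℝ, 0 < τ → τ < τ₀ → x ≤ C * (s + τ) ^ 2) : x ≤ C * s ^ 2 := by
  have hcont : Continuous fun τ : ℝ => C * (s + τ) ^ 2 := by fun_prop
  have hlim : Tendsto (fun τ : ℝ => C * (s + τ) ^ 2) (𝓝[>] (0 : ℝ)) (𝓝 (C * s ^ 2)) := by
    have h0 := (hcont.tendsto 0).mono_left (nhdsWithin_le_nhds (s := Ioi (0 : ℝ)))
    simpa using h0
  refine ge_of_tendsto hlim ?_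
  filter_upwards [Ioo_mem_nhdsGT hτ₀] with τ hτ using h τ hτ.1 hτ.2

/-- **ONE PLAQUETTE, ONE BOND: THE QUADRATIC SHAPE.**  Under the data of `norm_fderiv_comp_sgl_le_weighted`, for a
field with `‖A b′‖ ≤ s∕Wp` on the support and `2s < ε`: `wb³·‖Dφ(A) ∘ ι_b‖ ≤ 8·κ·Lc⁴·s²` (radius `(s + τ)∕wb`,
`τ ↓ 0`; at `s = 0` both sides vanish). [folklore] -/
theorem norm_fderiv_comp_sgl_le_weighted_sq {φ : (Λ → 𝔄) → ℂ} {S : Finset Λ} {ε κ Wp wb Lc s : ℝ}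
    (hWp : 0 < Wp) (hκ : 0 ≤ κ) (hLc1 : 1 ≤ Lc)
    (hd : DifferentiableOn ℂ φ {A : Λ → 𝔄 | ∀ b' ∈ S, ‖A b'‖ < ε / Wp})
    (hcub : ∀ (A : Λ → 𝔄) (σ : ℝ), 0 ≤ σ → σ < ε / Wp → (∀ b' ∈ S, ‖A b'‖ ≤ σ) → ‖φ A‖ ≤ κ / Wp * σ ^ 3)
    {b : Λ} (hwb : Wp ≤ wb) (hwL : wb ≤ Lc * Wp)
    {A : Λ → 𝔄} (hs : 0 ≤ s) (hA : ∀ b' ∈ S, ‖A b'‖ ≤ s / Wp) (h2s : 2 * s < ε) :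
    wb ^ 3 * ‖(fderiv ℂ φ A).comp (sgl b)‖ ≤ 8 * κ * Lc ^ 4 * s ^ 2 := by
  have hLc0 : 0 < Lc := one_pos.trans_le hLc1
  have hC0 : 0 ≤ 8 * κ * Lc ^ 4 := by positivity
  -- for every τ ∈ (0, ε − 2s): take t := s + τ in §1
  refine le_mul_sq_of_forall_add (τ₀ := ε - 2 * s) (by linarith) fun τ hτ hτε => ?_
  have ht : 0 < s + τ := by linarith
  have h1 := norm_fderiv_comp_sgl_le_weighted (b := b) hWp hκ hLc1 hd hcub hwb hwL hs hA ht (by linarith)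
  -- (s + (s+τ))³/(s+τ) ≤ (2(s+τ))³/(s+τ) = 8 (s+τ)²
  have h2 : (s + (s + τ)) ^ 3 / (s + τ) ≤ 8 * (s + τ) ^ 2 := by
    rw [div_le_iff₀ ht]
    have : s + (s + τ) ≤ 2 * (s + τ) := by linarith
    calc (s + (s + τ)) ^ 3 ≤ (2 * (s + τ)) ^ 3 := pow_le_pow_left₀ (by linarith) this 3
      _ = 8 * (s + τ) ^ 2 * (s + τ) := by ring
  calc wb ^ 3 * ‖(fderiv ℂ φ A).comp (sgl b)‖ ≤ κ * Lc ^ 4 * (s + (s + τ)) ^ 3 / (s + τ) := h1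
    _ = κ * Lc ^ 4 * ((s + (s + τ)) ^ 3 / (s + τ)) := by ring
    _ ≤ κ * Lc ^ 4 * (8 * (s + τ) ^ 2) := mul_le_mul_of_nonneg_left h2 (by positivity)
    _ = 8 * κ * Lc ^ 4 * (s + τ) ^ 2 := by ring

/-! ## §3 The local sum over the multi-grid: the (98) SHAPE for the `∇`-free plaquette part, VOLUME-FREE, k-UNIFORM -/

section Sum

variable {P : Type*} (Pl : Finset P) (φ : P → (Λ → 𝔄) → ℂ) (supp : P → Finset Λ)
  (w : Λ → ℝ) (W : P → ℝ)

omit [Fintype Λ] [DecidableEq Λ] [NormedSpace ℂ 𝔄] in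
/-- A field of weighted size `≤ s` (`w b·‖A b‖ ≤ s` for all `b`) has local size `≤ s∕W p` on the support of a plaquette
whose weight is dominated by its bonds' weights (`W p ≤ w b` on `supp p`). [folklore] -/
theorem local_size_le {A : Λ → 𝔄} {s : ℝ} (hA : ∀ b, w b * ‖A b‖ ≤ s)
    {p : P} (hWp : 0 < W p) (hWw : ∀ b ∈ supp p, W p ≤ w b) :
    ∀ b ∈ supp p, ‖A b‖ ≤ s / W p := by
  intro b hb
  rw [le_div_iff₀ hWp]
  calc ‖A b‖ * W p ≤ ‖A b‖ * w b := mul_le_mul_of_nonneg_left (hWw b hb) (norm_nonneg _)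
    _ = w b * ‖A b‖ := mul_comm _ _
    _ ≤ s := hA b

omit [Fintype Λ] [DecidableEq Λ] [NormedSpace ℂ 𝔄] in
/-- A field of weighted size `< ε` lies in every plaquette polydisc `{∀ b ∈ supp p, ‖A b‖ < ε∕W p}` (`W p ≤ w b` on
`supp p`). [folklore] -/
theorem mem_polydisc_of_wBall {A : Λ → 𝔄} {ε : ℝ} (hA : ∀ b, w b * ‖A b‖ < ε)
    {p : P} (hWp : 0 < W p) (hWw : ∀ b ∈ supp p, W p ≤ w b) :
    A ∈ {A : Λ → 𝔄 | ∀ b' ∈ supp p, ‖A b'‖ < ε / W p} := by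
  intro b hb
  rw [lt_div_iff₀ hWp]
  calc ‖A b‖ * W p ≤ ‖A b‖ * w b := mul_le_mul_of_nonneg_left (hWw b hb) (norm_nonneg _)
    _ = w b * ‖A b‖ := mul_comm _ _
    _ < ε := hA b

/-- **THE (98) SHAPE FOR THE `∇`-FREE PLAQUETTE PART, BOND BY BOND = THE (97) DISPLAY.**  Data: weights `w b > 0`
(bonds), `W p > 0` (plaquettes) with `W p ≤ w b ≤ Lc·W p` on `supp p`, `1 ≤ Lc`; every `φ_p` LOCAL to `supp p`,
ℂ-differentiable on the weighted polydisc `{∀ b ∈ supp p, ‖A b‖ < ε∕W p}` with the (40)-SHAPE cubic bound (constant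
`κ∕W p`); at most `m` plaquettes through any bond.  Then for a field with `w b·‖A b‖ ≤ s` for all `b` and `2s < ε`,
and EVERY bond `b`:  `(w b)³ · ‖locGrad (Σ_{p∈Pl} φ_p) A b‖ ≤ 8·κ·m·Lc⁴·s²`.  For Bałaban's `w b = L^{j(b)}η`,
`s = ε₃`: the display «< C₄ε₃²(Lʲη)^{−3} on Ω_j» of (97) for this part, with `C₄ = 8κ·m·Lc⁴` made of ONE plaquette's
constant, the incidence number and the scale jump — independent of `#Pl`, `#Λ` and of the number of scales.  Nothing
printed is asserted. [folklore] -/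
theorem weighted_locGrad_le' {ε κ Lc s : ℝ} {m : ℕ} (hκ : 0 ≤ κ) (hLc1 : 1 ≤ Lc)
    (hw : ∀ b, 0 < w b) (hW : ∀ p ∈ Pl, 0 < W p)
    (hWw : ∀ p ∈ Pl, ∀ b ∈ supp p, W p ≤ w b) (hwW : ∀ p ∈ Pl, ∀ b ∈ supp p, w b ≤ Lc * W p)
    (hd : ∀ p ∈ Pl, DifferentiableOn ℂ (φ p) {A : Λ → 𝔄 | ∀ b' ∈ supp p, ‖A b'‖ < ε / W p})
    (hcub : ∀ p ∈ Pl, ∀ (A : Λ → 𝔄) (σ : ℝ), 0 ≤ σ → σ < ε / W p → (∀ b' ∈ supp p, ‖A b'‖ ≤ σ) →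
      ‖φ p A‖ ≤ κ / W p * σ ^ 3)
    (hloc : ∀ p ∈ Pl, ∀ A : Λ → 𝔄, ∀ b ∉ supp p, ∀ X : 𝔄, φ p (A + Pi.single b X) = φ p A)
    (hm : ∀ b : Λ, (Pl.filter (fun p => b ∈ supp p)).card ≤ m)
    {A : Λ → 𝔄} (hs : 0 ≤ s) (hA : ∀ b, w b * ‖A b‖ ≤ s) (h2s : 2 * s < ε) (b : Λ) :
    w b ^ 3 * ‖locGrad (fun A => ∑ p ∈ Pl, φ p A) A b‖ ≤ 8 * κ * m * Lc ^ 4 * s ^ 2 := by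
  have hwb : 0 < w b := hw b
  have hε : 0 < ε := by linarith
  -- `A` lies in every polydisc, so every `φ_p` is differentiable at `A`
  have hAlt : ∀ b', w b' * ‖A b'‖ < ε := fun b' => (hA b').trans_lt (by linarith)
  have hφA : ∀ p ∈ Pl, DifferentiableAt ℂ (φ p) A := fun p hp =>
    (hd p hp).differentiableAt ((isOpen_polydisc (supp p) _).mem_nhds
      (mem_polydisc_of_wBall supp w W hAlt (hW p hp) (hWw p hp)))
  -- (90), `st(b)`-half: only the plaquettes through `b` contribute
  rw [locGrad_sum_eq_filter Pl φ supp hφA hloc b]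
  -- each contributes ≤ 8κLc⁴s²/(w b)³
  have hterm : ∀ p ∈ Pl.filter (fun p => b ∈ supp p),
      w b ^ 3 * ‖(fderiv ℂ (φ p) A).comp (sgl b)‖ ≤ 8 * κ * Lc ^ 4 * s ^ 2 := by
    intro p hp
    rw [Finset.mem_filter] at hp
    exact norm_fderiv_comp_sgl_le_weighted_sq (hW p hp.1) hκ hLc1 (hd p hp.1) (hcub p hp.1)
      (hWw p hp.1 b hp.2) (hwW p hp.1 b hp.2) hs (local_size_le supp w W hA (hW p hp.1) (hWw p hp.1)) h2s
  have hterm' : ∀ p ∈ Pl.filter (fun p => b ∈ supp p),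
      ‖(fderiv ℂ (φ p) A).comp (sgl b)‖ ≤ 8 * κ * Lc ^ 4 * s ^ 2 / w b ^ 3 := by
    intro p hp
    rw [le_div_iff₀ (pow_pos hwb 3), mul_comm]
    exact hterm p hp
  calc w b ^ 3 * ‖∑ p ∈ Pl.filter (fun p => b ∈ supp p), (fderiv ℂ (φ p) A).comp (sgl b)‖
      ≤ w b ^ 3 * ∑ p ∈ Pl.filter (fun p => b ∈ supp p), 8 * κ * Lc ^ 4 * s ^ 2 / w b ^ 3 :=
        mul_le_mul_of_nonneg_left (norm_sum_le_of_le _ hterm') (pow_nonneg hwb.le 3)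
    _ = ((Pl.filter (fun p => b ∈ supp p)).card : ℝ) * (8 * κ * Lc ^ 4 * s ^ 2) := by
        rw [Finset.sum_const, nsmul_eq_mul]
        field_simp
    _ ≤ (m : ℝ) * (8 * κ * Lc ^ 4 * s ^ 2) := by
        have h0 : 0 ≤ 8 * κ * Lc ^ 4 * s ^ 2 := by
          have : 0 ≤ Lc := zero_le_one.trans hLc1
          positivity
        exact mul_le_mul_of_nonneg_right (by exact_mod_cast hm b) h0
    _ = 8 * κ * m * Lc ^ 4 * s ^ 2 := by ring

/-- **THE (98) SHAPE, SUP FORM.**  Same data; conclusion as ONE inequality for the weighted sup of the gradient field: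
`sup_b (w b)³‖locGrad V A b‖ ≤ 8κ·m·Lc⁴·s²`, stated as «every weighted component is below the bound» through
`∀ b` (the weighted sup norm `|·|_{(−3)}` itself is packaged in `ShellMeasureMultiGridNorms`).  In (98)'s words, for
this part: `|(δ∕δA′)V₀′|_{(−3)} ≤ C₄·|A′|²_{(−1)} ≤ C₄·(max{|A′|_{(−1)}, |∇A′|_{(−2)}})²`. [folklore] -/
theorem weighted_locGrad_le {ε κ Lc : ℝ} {m : ℕ} (hκ : 0 ≤ κ) (hLc1 : 1 ≤ Lc)
    (hw : ∀ b, 0 < w b) (hW : ∀ p ∈ Pl, 0 < W p)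
    (hWw : ∀ p ∈ Pl, ∀ b ∈ supp p, W p ≤ w b) (hwW : ∀ p ∈ Pl, ∀ b ∈ supp p, w b ≤ Lc * W p)
    (hd : ∀ p ∈ Pl, DifferentiableOn ℂ (φ p) {A : Λ → 𝔄 | ∀ b' ∈ supp p, ‖A b'‖ < ε / W p})
    (hcub : ∀ p ∈ Pl, ∀ (A : Λ → 𝔄) (σ : ℝ), 0 ≤ σ → σ < ε / W p → (∀ b' ∈ supp p, ‖A b'‖ ≤ σ) →
      ‖φ p A‖ ≤ κ / W p * σ ^ 3)
    (hloc : ∀ p ∈ Pl, ∀ A : Λ → 𝔄, ∀ b ∉ supp p, ∀ X : 𝔄, φ p (A + Pi.single b X) = φ p A)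
    (hm : ∀ b : Λ, (Pl.filter (fun p => b ∈ supp p)).card ≤ m)
    {A : Λ → 𝔄} {s : ℝ} (hs : 0 ≤ s) (hA : ∀ b, w b * ‖A b‖ ≤ s) (h2s : 2 * s < ε) :
    ∀ b : Λ, w b ^ 3 * ‖locGrad (fun A => ∑ p ∈ Pl, φ p A) A b‖ ≤ 8 * κ * m * Lc ^ 4 * s ^ 2 := fun b =>
  weighted_locGrad_le' Pl φ supp w W hκ hLc1 hw hW hWw hwW hd hcub hloc hm hs hA h2s b

/-! ## §4 Analyticity of the sum and differentiability of its bond-local gradient on the weighted ball -/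

omit [DecidableEq Λ] [NormedSpace ℂ 𝔄] in
/-- The weighted ball `{A : ∀ b, w b·‖A b‖ < a}` is open. [folklore] -/
theorem isOpen_wBall (a : ℝ) : IsOpen {A : Λ → 𝔄 | ∀ b, w b * ‖A b‖ < a} := by
  have h : {A : Λ → 𝔄 | ∀ b, w b * ‖A b‖ < a} = ⋂ b, {A : Λ → 𝔄 | w b * ‖A b‖ < a} := by
    ext A; simp
  rw [h]
  exact isOpen_iInter_of_finite fun b =>
    isOpen_lt (continuous_const.mul (continuous_norm.comp (continuous_apply b))) continuous_const

omit [DecidableEq Λ] in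
/-- The sum `V = Σ_{p∈Pl} φ_p` is analytic on the weighted ball of radius `ε` when every `φ_p` is analytic on its
polydisc (which contains the ball). [folklore] -/
theorem analyticOnNhd_sum_wBall {ε : ℝ} (hW : ∀ p ∈ Pl, 0 < W p)
    (hWw : ∀ p ∈ Pl, ∀ b ∈ supp p, W p ≤ w b)
    (ha : ∀ p ∈ Pl, AnalyticOnNhd ℂ (φ p) {A : Λ → 𝔄 | ∀ b' ∈ supp p, ‖A b'‖ < ε / W p}) :
    AnalyticOnNhd ℂ (fun A => ∑ p ∈ Pl, φ p A) {A : Λ → 𝔄 | ∀ b, w b * ‖A b‖ < ε} :=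
  Finset.analyticOnNhd_fun_sum Pl fun p hp A hA =>
    ha p hp A (mem_polydisc_of_wBall supp w W hA (hW p hp) (hWw p hp))

/-- `locGrad V` is ℂ-differentiable on any set where `V` is analytic (coordinatewise `DV(·) ∘ ι_b`). [folklore] -/
theorem differentiableOn_locGrad_of_analyticOnNhd {V : (Λ → 𝔄) → ℂ} {U : Set (Λ → 𝔄)}
    (hV : AnalyticOnNhd ℂ V U) : DifferentiableOn ℂ (locGrad V) U :=
  differentiableOn_pi.2 fun b => hV.fderiv.differentiableOn.clm_comp (differentiableOn_const (sgl b))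

/-- **THE `DifferentiableOn` CLAUSE OF (98) (flat coordinates).**  `locGrad (Σ_p φ_p)` is ℂ-differentiable on the
weighted ball `{∀ b, w b·‖A b‖ < ε}`. [folklore] -/
theorem differentiableOn_locGrad_wBall {ε : ℝ} (hW : ∀ p ∈ Pl, 0 < W p)
    (hWw : ∀ p ∈ Pl, ∀ b ∈ supp p, W p ≤ w b)
    (ha : ∀ p ∈ Pl, AnalyticOnNhd ℂ (φ p) {A : Λ → 𝔄 | ∀ b' ∈ supp p, ‖A b'‖ < ε / W p}) :
    DifferentiableOn ℂ (locGrad (fun A => ∑ p ∈ Pl, φ p A)) {A : Λ → 𝔄 | ∀ b, w b * ‖A b‖ < ε} :=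
  differentiableOn_locGrad_of_analyticOnNhd (analyticOnNhd_sum_wBall Pl φ supp w W hW hWw ha)

end Sum

/-! ## §5 Non-vacuity: one plaquette, `φ A = (ℓ (A b₀))³` -/

/-- The data of §3 are inhabited with a live cubic functional: one plaquette supported on `{b₀}`, `φ A = (ℓ(A b₀))³`
for a functional `ℓ` of norm `≤ 1`, weights `w ≡ W ≡ 1`, `κ = 1`, `Lc = 1`, `m = 1`, any `ε > 2s`; the conclusion of
`weighted_locGrad_le` then reads `‖locGrad φ A b‖ ≤ 8s²`. [folklore] -/
theorem nonvacuity (ℓ : 𝔄 →L[ℂ] ℂ) (hℓ : ‖ℓ‖ ≤ 1) (b₀ : Λ) {ε : ℝ} {A : Λ → 𝔄} {s : ℝ} (hs : 0 ≤ s)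
    (hA : ∀ b, ‖A b‖ ≤ s) (h2s : 2 * s < ε) (b : Λ) :
    ‖locGrad (fun A : Λ → 𝔄 => (ℓ (A b₀)) ^ 3) A b‖ ≤ 8 * s ^ 2 := by
  -- analytic everywhere, in particular differentiable on the polydisc
  have hd : ∀ p ∈ ({()} : Finset Unit), DifferentiableOn ℂ ((fun (_ : Unit) (A : Λ → 𝔄) => (ℓ (A b₀)) ^ 3) p)
      {A : Λ → 𝔄 | ∀ b' ∈ (fun _ : Unit => ({b₀} : Finset Λ)) p, ‖A b'‖ < ε / (fun _ : Unit => (1 : ℝ)) p} := by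
    intro p _
    have h : Differentiable ℂ fun A : Λ → 𝔄 => (ℓ (A b₀)) ^ 3 :=
      (ℓ.differentiable.comp (ContinuousLinearMap.proj (R := ℂ) (φ := fun _ : Λ => 𝔄) b₀).differentiable).pow 3
    exact h.differentiableOn
  -- the cubic bound with κ = W = 1
  have hcub : ∀ p ∈ ({()} : Finset Unit), ∀ (A : Λ → 𝔄) (σ : ℝ), 0 ≤ σ → σ < ε / (fun _ : Unit => (1 : ℝ)) p →
      (∀ b' ∈ (fun _ : Unit => ({b₀} : Finset Λ)) p, ‖A b'‖ ≤ σ) →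
      ‖(fun (_ : Unit) (A : Λ → 𝔄) => (ℓ (A b₀)) ^ 3) p A‖ ≤ 1 / (fun _ : Unit => (1 : ℝ)) p * σ ^ 3 := by
    intro p _ A σ _ _ hAσ
    have hb : ‖A b₀‖ ≤ σ := hAσ b₀ (Finset.mem_singleton_self b₀)
    calc ‖(ℓ (A b₀)) ^ 3‖ = ‖ℓ (A b₀)‖ ^ 3 := norm_pow _ 3
      _ ≤ σ ^ 3 := by
          refine pow_le_pow_left₀ (norm_nonneg _) ?_ 3
          calc ‖ℓ (A b₀)‖ ≤ ‖ℓ‖ * ‖A b₀‖ := ℓ.le_opNorm _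
            _ ≤ 1 * σ := mul_le_mul hℓ hb (norm_nonneg _) zero_le_one
            _ = σ := one_mul σ
      _ = 1 / 1 * σ ^ 3 := by ring
  -- locality: blind to the bonds off {b₀}
  have hloc : ∀ p ∈ ({()} : Finset Unit), ∀ (A : Λ → 𝔄), ∀ b ∉ (fun _ : Unit => ({b₀} : Finset Λ)) p, ∀ X : 𝔄,
      (fun (_ : Unit) (A : Λ → 𝔄) => (ℓ (A b₀)) ^ 3) p (A + Pi.single b X) =
        (fun (_ : Unit) (A : Λ → 𝔄) => (ℓ (A b₀)) ^ 3) p A := by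
    intro p _ A b hb X
    have hb' : b₀ ≠ b := fun h => hb (by simp [h])
    have h0 : (Pi.single b X : Λ → 𝔄) b₀ = 0 := by simp [hb']
    simp [h0]
  -- incidence: one plaquette
  have hm : ∀ b : Λ, (({()} : Finset Unit).filter (fun p => b ∈ (fun _ : Unit => ({b₀} : Finset Λ)) p)).card ≤ 1 :=
    fun b => (Finset.card_filter_le _ _).trans (by simp)
  have key := weighted_locGrad_le ({()} : Finset Unit) (fun (_ : Unit) (A : Λ → 𝔄) => (ℓ (A b₀)) ^ 3)
    (fun _ : Unit => ({b₀} : Finset Λ)) (fun _ : Λ => (1 : ℝ)) (fun _ : Unit => (1 : ℝ)) (ε := ε) (κ := 1) (Lc := 1)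
    (m := 1) zero_le_one le_rfl (fun _ => one_pos) (fun _ _ => one_pos) (fun _ _ _ _ => le_rfl)
    (fun _ _ _ _ => by norm_num) hd hcub hloc hm hs (fun b => by simpa using hA b) h2s b
  simpa using key

end Summit.QuantumFields.BalabanUV.T4Continuum.ShellMeasureGradientTailLevels

end
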